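import Literature.RingTheory.Henselian.FiniteFlatHopfAlgebraUnitFactorLocalization
import Literature.AlgebraicGeometry.Motives.TannakianHopfAntipode
import Mathlib.RingTheory.HopfAlgebra.Quotient
import Mathlib.RingTheory.LocalRing.ResidueField.Fiber
import Mathlib.LinearAlgebra.Dimension.Constructions
import HarnessLib

/-!
# The unit factor of a finite commutative Hopf algebra over a local ring is a Hopf quotient
# ([Tate1997FiniteFlatGroupSchemes] (3.7) (I): `G⁰` is a closed subgroup scheme; [StacksProject] 04GG)

Topic `Literature/RingTheory/Henselian`; namespace `Literature.RingTheory.Henselian`.  PROOF FILE (theorems only; no definition,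
no named fact, no instance, no notation, no `sorry`).  Cell `hodgecm-mathlib` (D-0151), FLOOR-0 P5a row G3, file (B5) of
F0P5a-plan (g5)'s WORD 07:27:25Z (2) «the unit local factor is a HOPF QUOTIENT».  Setting: `R` local, `B` a commutative
`R`-bialgebra ∕ Hopf algebra (`G = Spec B`), `𝔫_ε = RingHom.ker ((IsLocalRing.residue R).comp (Bialgebra.counitAlgHom R B))` the
unit maximal ideal, `e` its separating idempotent (`he1 : e - 1 ∈ 𝔫_ε`, `he0 : e ∈ 𝔫` for maximal `𝔫 ≠ 𝔫_ε`; exists over a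
henselian base, ★ `exists_unit_idempotent`), `B₀ = B ⧸ (1 - e) ≃ₐ[R] Localization.AtPrime 𝔫_ε` the unit corner ∕ factor.

* §1 ANTIPODE: `comap_antipode_ker_residue_counit` (`S⁻¹ 𝔫_ε = 𝔫_ε`, Mathlib `counitAlgHom_comp_antipodeAlgHom`) and
  **`antipode_unitIdempotent_eq`** (`S e = e`; the antipode of a commutative Hopf algebra is an involutive algebra automorphism,
  ★ `Tannakian.Hopf.antipode_antipode_of_commutative`, so it permutes separating idempotents, ★ `map_separatingIdempotent_eq`).
* §2 HOPF IDEAL: **`isHopfIdeal_span_one_sub`** — for `B` module-finite, `(1 - e)` is a Mathlib `Ideal.IsHopfIdeal R`: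
  `ε (1 - e) = 0`, `(mk ⊗ mk) Δ(x) = 0` on it (★ `map_mk_mk_comul_eq_one`, «`G⁰ G⁰ = G⁰`»), `S (1 - e) ⊆ (1 - e)`.  CONSEQUENCE
  (Mathlib, by instance, nothing restated here): `Bialgebra R (B ⧸ (1 - e))`, `HopfAlgebra R (B ⧸ (1 - e))`
  (`Mathlib.RingTheory.{Bialgebra,HopfAlgebra}.Quotient`) with `Ideal.Quotient.mkₐ` a bialgebra map (`Bialgebra.Quotient.mkBialgHom`)
  — i.e. `G⁰ = Spec B₀ ↪ G` IS A CLOSED SUBGROUP SCHEME; its comultiplication∕counit are the descended maps of ★ (B2)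
  (`existsUnique_comul_unitCorner` ∕ `existsUnique_counit_unitCorner`, uniqueness).
* §3 CO-LAWS OF A DESCENDED PAIR, GENERIC: for any algebra map `π : B → C` which is an epimorphism towards the relevant
  target and any `(ΔC, εC)` with `ΔC ∘ π = (π ⊗ π) ∘ Δ`, `εC ∘ π = ε`: **`map_counit_id_comp_comul_of_comp_eq`**,
  **`map_id_counit_comp_comul_of_comp_eq`**, **`coassoc_comul_of_comp_eq`** — the three hypotheses of Mathlib
  `Bialgebra.ofAlgHom`, from `B`'s own laws; instances on the unit local factor `Localization.AtPrime 𝔫_ε`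
  (`map_counit_id_comp_comul_localization`, `map_id_counit_comp_comul_localization`, via ★ `algHom_localization_ext`;
  coassociativity = the generic lemma at `π = algebraMap`, see the note in §3).
* §4 SPECIAL FIBRE OF THE UNIT FACTOR: `isLocalRing_residueField_tensor_unitCorner` (`k ⊗_R B₀` is local — it is a factor of the
  special fibre `k ⊗_R B` through the unit, Mathlib instance) and **`finrank_residueField_tensor_localization_eq`**:
  `rank_k (k ⊗_R B_{𝔫_ε}) = rank_R B_{𝔫_ε}` for `B` finite free («`[G⁰ : S] = [Ḡ⁰ : Spec k]`»).
* §5 SURJECTIVITY OF REDUCTION ON POINTS (valuation ring of an algebraically closed field, `B` finite free with reduced generic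
  fibre): **`exists_algHom_residue_comp_eq`** — every `κ(V)`-point lifts to a `V`-point (the fibre has
  `rank (local factor) ≥ 1` elements by ★ `card_algHom_residue_comp_eq_finrank_localization`).

HC_CM is proved only modulo the 7 printed citations until rung 0 closes; this file is generic algebra and changes no count.

## References
* [Tate1997FiniteFlatGroupSchemes] J. Tate, *Finite flat group schemes*, in: Cornell–Silverman–Stevens (eds.), *Modular Forms and
  Fermat's Last Theorem* (Springer 1997), (3.7) (I) («`G⁰` … is a flat closed normal subgroup scheme of `G`»; «the inverse
  morphism preserves `G⁰`»).
* [StacksProject] The Stacks Project, Tags 04GG, 04GH.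
* [Montgomery1993Hopf] S. Montgomery, *Hopf algebras and their actions on rings* (1993), Cor. 1.5.12 (`S² = id` for commutative `H`).
-/

set_option autoImplicit false

noncomputable section

universe u v

open IsLocalRing TensorProduct

namespace Literature.RingTheory.Henselian

/-! ## §1 The antipode fixes the unit idempotent -/

section Antipode

variable {R : Type u} [CommRing R] [IsLocalRing R] {B : Type v} [CommRing B] [HopfAlgebra R B]

/-- `S⁻¹ 𝔫_ε = 𝔫_ε`: the antipode preserves the unit maximal ideal (`ε ∘ S = ε`). [cite: Tate1997FiniteFlatGroupSchemes, (3.7) (I)] -/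
theorem comap_antipode_ker_residue_counit :
    (RingHom.ker ((residue R).comp (Bialgebra.counitAlgHom R B : B →+* R))).comap
        (HopfAlgebra.antipodeAlgHom R B : B →+* B) =
      RingHom.ker ((residue R).comp (Bialgebra.counitAlgHom R B : B →+* R)) := by
  rw [RingHom.comap_ker, RingHom.comp_assoc, ← AlgHom.comp_toRingHom, AlgHom.counitAlgHom_comp_antipodeAlgHom]

/-- **The antipode fixes the unit idempotent**: `S e = e` (the antipode of a commutative Hopf algebra is an involutive algebra
automorphism preserving `𝔫_ε`, hence it permutes the separating idempotents and fixes the one at `𝔫_ε`).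
[cite: Tate1997FiniteFlatGroupSchemes, (3.7) (I)] -/
theorem antipode_unitIdempotent_eq {e : B} (he : IsIdempotentElem e)
    (he1 : e - 1 ∈ RingHom.ker ((residue R).comp (Bialgebra.counitAlgHom R B : B →+* R)))
    (he0 : ∀ 𝔫 : Ideal B, 𝔫.IsMaximal → 𝔫 ≠ RingHom.ker ((residue R).comp (Bialgebra.counitAlgHom R B : B →+* R)) →
      e ∈ 𝔫) :
    HopfAlgebra.antipode R e = e := by
  set σ : B ≃ₐ[R] B := AlgEquiv.ofBijective (HopfAlgebra.antipodeAlgHom R B)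
    (Literature.AlgebraicGeometry.Motives.Tannakian.Hopf.antipode_bijective_of_commutative (R := R) (A := B)) with hσ
  have hcomap : (RingHom.ker ((residue R).comp (Bialgebra.counitAlgHom R B : B →+* R))).comap (σ : B →+* B) =
      RingHom.ker ((residue R).comp (Bialgebra.counitAlgHom R B : B →+* R)) := by
    ext x
    have hx : Bialgebra.counitAlgHom R B ((σ : B →+* B) x) = Bialgebra.counitAlgHom R B x := by
      change Bialgebra.counitAlgHom R B (HopfAlgebra.antipodeAlgHom R B x) = _
      rw [← AlgHom.comp_apply, AlgHom.counitAlgHom_comp_antipodeAlgHom]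
    simp only [Ideal.mem_comap, RingHom.mem_ker, RingHom.coe_comp, Function.comp_apply, AlgHom.coe_toRingHom, hx]
  have := map_separatingIdempotent_eq σ _ _ hcomap he he he1 he0 he1 he0
  simpa [hσ] using this

/-- The antipode preserves the ideal `(1 - e)` of the unit corner. [cite: Tate1997FiniteFlatGroupSchemes, (3.7) (I)] -/
theorem antipode_mem_span_one_sub {e : B} (he : IsIdempotentElem e)
    (he1 : e - 1 ∈ RingHom.ker ((residue R).comp (Bialgebra.counitAlgHom R B : B →+* R)))
    (he0 : ∀ 𝔫 : Ideal B, 𝔫.IsMaximal → 𝔫 ≠ RingHom.ker ((residue R).comp (Bialgebra.counitAlgHom R B : B →+* R)) →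
      e ∈ 𝔫) {x : B} (hx : x ∈ Ideal.span {1 - e}) :
    HopfAlgebra.antipode R x ∈ Ideal.span {1 - e} := by
  rw [Ideal.mem_span_singleton] at hx ⊢
  obtain ⟨c, rfl⟩ := hx
  refine ⟨HopfAlgebra.antipode R c, ?_⟩
  rw [← HopfAlgebra.antipodeAlgHom_apply, map_mul, map_sub, map_one, HopfAlgebra.antipodeAlgHom_apply,
    antipode_unitIdempotent_eq he he1 he0]
  rfl

end Antipode

/-! ## §2 `(1 - e)` is a Hopf ideal: the unit corner is a quotient Hopf algebra -/

section HopfIdeal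

variable {R : Type u} [CommRing R] [IsLocalRing R] {B : Type v} [CommRing B]

/-- **The ideal of the unit corner is a coideal** (`B` a module-finite commutative bialgebra over a local ring):
`ε` vanishes on `(1 - e)` and `(mk ⊗ mk) ∘ Δ` kills it («`G⁰ G⁰ = G⁰`», ★ `map_mk_mk_comul_eq_one`).
[cite: Tate1997FiniteFlatGroupSchemes, (3.7) (I)] -/
theorem isCoideal_span_one_sub [Bialgebra R B] [Module.Finite R B] {e : B} (he : IsIdempotentElem e)
    (he1 : e - 1 ∈ RingHom.ker ((residue R).comp (Bialgebra.counitAlgHom R B : B →+* R)))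
    (he0 : ∀ 𝔫 : Ideal B, 𝔫.IsMaximal → 𝔫 ≠ RingHom.ker ((residue R).comp (Bialgebra.counitAlgHom R B : B →+* R)) →
      e ∈ 𝔫) :
    ((Ideal.span {1 - e}).restrictScalars R).IsCoideal := by
  refine ⟨fun x hx => ?_, fun x hx => ?_⟩
  · exact span_one_sub_le_ker_counit (R := R) he he1 hx
  · change (Algebra.TensorProduct.map (Ideal.Quotient.mkₐ R (Ideal.span {1 - e}))
      (Ideal.Quotient.mkₐ R (Ideal.span {1 - e}))) (Bialgebra.comulAlgHom R B x) = 0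
    have hx' : x ∈ Ideal.span {1 - e} := hx
    rw [Ideal.mem_span_singleton] at hx'
    obtain ⟨c, rfl⟩ := hx'
    rw [map_mul, map_mul, map_sub, map_sub, map_one, map_one, Bialgebra.comulAlgHom_apply,
      map_mk_mk_comul_eq_one (R := R) he he1 he0, sub_self, zero_mul]

/-- **The ideal of the unit corner is a HOPF IDEAL** (Mathlib `Ideal.IsHopfIdeal`): coideal and stable under the antipode.  Hence,
by Mathlib `HopfAlgebra.Quotient`, `B ⧸ (1 - e)` carries the quotient Hopf-algebra structure and `mkₐ` is a bialgebra map: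
`G⁰ ↪ G` is a closed subgroup scheme. [cite: Tate1997FiniteFlatGroupSchemes, (3.7) (I)] -/
theorem isHopfIdeal_span_one_sub [HopfAlgebra R B] [Module.Finite R B] {e : B} (he : IsIdempotentElem e)
    (he1 : e - 1 ∈ RingHom.ker ((residue R).comp (Bialgebra.counitAlgHom R B : B →+* R)))
    (he0 : ∀ 𝔫 : Ideal B, 𝔫.IsMaximal → 𝔫 ≠ RingHom.ker ((residue R).comp (Bialgebra.counitAlgHom R B : B →+* R)) →
      e ∈ 𝔫) :
    (Ideal.span {1 - e}).IsHopfIdeal R :=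
  { toIsCoideal := isCoideal_span_one_sub (R := R) he he1 he0
    antipode_mem := fun _ hx => antipode_mem_span_one_sub (R := R) he he1 he0 hx }

/-- Over a HENSELIAN local base (`B` module-finite commutative Hopf algebra) the unit maximal ideal `𝔫_ε` admits a separating
idempotent whose ideal `(1 - e)` is a Hopf ideal — the unit factor `B_{𝔫_ε} ≃ B ⧸ (1 - e)` is a quotient Hopf algebra.
[cite: Tate1997FiniteFlatGroupSchemes, (3.7) (I)] -/
theorem exists_isHopfIdeal_unitFactor {R : Type u} [CommRing R] [HenselianLocalRing R] {B : Type v} [CommRing B]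
    [HopfAlgebra R B] [Module.Finite R B] :
    ∃ e : B, IsIdempotentElem e ∧ e - 1 ∈ RingHom.ker ((residue R).comp (Bialgebra.counitAlgHom R B : B →+* R)) ∧
      (∀ 𝔫 : Ideal B, 𝔫.IsMaximal → 𝔫 ≠ RingHom.ker ((residue R).comp (Bialgebra.counitAlgHom R B : B →+* R)) → e ∈ 𝔫) ∧
      (Ideal.span {1 - e}).IsHopfIdeal R := by
  obtain ⟨e, he, he1, he0⟩ := exists_unit_idempotent (R := R) (B := B)
  exact ⟨e, he, he1, he0, isHopfIdeal_span_one_sub (R := R) he he1 he0⟩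

end HopfIdeal

/-! ## §3 Co-laws of a descended pair (generic), and of the localised pair -/

section DescentLaws

variable {R : Type u} [CommRing R] {B : Type v} [CommRing B] [Bialgebra R B]
variable {C : Type v} [CommRing C] [Algebra R C] (π : B →ₐ[R] C)

/-- **Counit law `h_rTensor` for a descended pair.**  Let `π : B → C` be an algebra map which is an epimorphism towards
`R ⊗ C` (`hext`), and `(ΔC, εC)` algebra maps with `ΔC ∘ π = (π ⊗ π) ∘ Δ`, `εC ∘ π = ε`.  Then `(εC ⊗ id) ∘ ΔC = lid⁻¹`
(shape of Mathlib `Bialgebra.ofAlgHom`).  Instances: `π = mk` onto the unit corner (★ `map_counit_id_comp_comul_unitCorner`),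
`π = algebraMap` to the unit local factor (below). [cite: Tate1997FiniteFlatGroupSchemes, (3.7) (I)] -/
theorem map_counit_id_comp_comul_of_comp_eq (hext : ∀ f g : C →ₐ[R] R ⊗[R] C, f.comp π = g.comp π → f = g)
    (ΔC : C →ₐ[R] C ⊗[R] C) (hΔ : ΔC.comp π = (Algebra.TensorProduct.map π π).comp (Bialgebra.comulAlgHom R B))
    (εC : C →ₐ[R] R) (hε : εC.comp π = Bialgebra.counitAlgHom R B) :
    (Algebra.TensorProduct.map εC (AlgHom.id R C)).comp ΔC = ((Algebra.TensorProduct.lid R C).symm : C →ₐ[R] R ⊗[R] C) := by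
  refine hext _ _ (AlgHom.ext fun b => ?_)
  have h := congrArg (fun φ => Algebra.TensorProduct.map εC (AlgHom.id R C) (φ b)) hΔ
  simp only [AlgHom.comp_apply] at h ⊢
  rw [h, ← AlgHom.comp_apply, ← Algebra.TensorProduct.map_comp, hε, AlgHom.id_comp]
  have h2 : Algebra.TensorProduct.map (Bialgebra.counitAlgHom R B) π =
      (Algebra.TensorProduct.map (AlgHom.id R R) π).comp
        (Algebra.TensorProduct.map (Bialgebra.counitAlgHom R B) (AlgHom.id R B)) := by
    rw [← Algebra.TensorProduct.map_comp, AlgHom.id_comp, AlgHom.comp_id]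
  rw [h2, AlgHom.comp_apply, Bialgebra.comulAlgHom_apply, map_counitAlgHom_id_comul, Algebra.TensorProduct.map_tmul,
    map_one]
  rfl

/-- **Counit law `h_lTensor` for a descended pair**: `(id ⊗ εC) ∘ ΔC = rid⁻¹`. [cite: Tate1997FiniteFlatGroupSchemes, (3.7) (I)] -/
theorem map_id_counit_comp_comul_of_comp_eq (hext : ∀ f g : C →ₐ[R] C ⊗[R] R, f.comp π = g.comp π → f = g)
    (ΔC : C →ₐ[R] C ⊗[R] C) (hΔ : ΔC.comp π = (Algebra.TensorProduct.map π π).comp (Bialgebra.comulAlgHom R B))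
    (εC : C →ₐ[R] R) (hε : εC.comp π = Bialgebra.counitAlgHom R B) :
    (Algebra.TensorProduct.map (AlgHom.id R C) εC).comp ΔC = ((Algebra.TensorProduct.rid R R C).symm : C →ₐ[R] C ⊗[R] R) := by
  refine hext _ _ (AlgHom.ext fun b => ?_)
  have h := congrArg (fun φ => Algebra.TensorProduct.map (AlgHom.id R C) εC (φ b)) hΔ
  simp only [AlgHom.comp_apply] at h ⊢
  rw [h, ← AlgHom.comp_apply, ← Algebra.TensorProduct.map_comp, hε, AlgHom.id_comp]
  have h2 : Algebra.TensorProduct.map π (Bialgebra.counitAlgHom R B) =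
      (Algebra.TensorProduct.map π (AlgHom.id R R)).comp
        (Algebra.TensorProduct.map (AlgHom.id R B) (Bialgebra.counitAlgHom R B)) := by
    rw [← Algebra.TensorProduct.map_comp, AlgHom.id_comp, AlgHom.comp_id]
  rw [h2, AlgHom.comp_apply, Bialgebra.comulAlgHom_apply, map_id_counitAlgHom_comul, Algebra.TensorProduct.map_tmul,
    map_one]
  rfl

/-- **Coassociativity `h_coassoc` for a descended comultiplication**: `assoc ∘ (ΔC ⊗ id) ∘ ΔC = (id ⊗ ΔC) ∘ ΔC` when `π` is an
epimorphism towards `C ⊗ (C ⊗ C)`. [cite: Tate1997FiniteFlatGroupSchemes, (3.7) (I)] -/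
theorem coassoc_comul_of_comp_eq (hext : ∀ f g : C →ₐ[R] C ⊗[R] (C ⊗[R] C), f.comp π = g.comp π → f = g)
    (ΔC : C →ₐ[R] C ⊗[R] C) (hΔ : ΔC.comp π = (Algebra.TensorProduct.map π π).comp (Bialgebra.comulAlgHom R B)) :
    (Algebra.TensorProduct.assoc R R R C C C).toAlgHom.comp ((Algebra.TensorProduct.map ΔC (AlgHom.id R C)).comp ΔC) =
      (Algebra.TensorProduct.map (AlgHom.id R C) ΔC).comp ΔC := by
  refine hext _ _ (AlgHom.ext fun b => ?_)
  have hΔb : ∀ b : B, ΔC (π b) = Algebra.TensorProduct.map π π (Coalgebra.comul (R := R) b) := fun b => by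
    have := congrArg (fun φ => φ b) hΔ
    simpa [AlgHom.comp_apply] using this
  have key1 : ∀ x : B ⊗[R] B,
      Algebra.TensorProduct.map ΔC (AlgHom.id R C) (Algebra.TensorProduct.map π π x) =
        Algebra.TensorProduct.map (Algebra.TensorProduct.map π π) π
          (Algebra.TensorProduct.map (Bialgebra.comulAlgHom R B) (AlgHom.id R B) x) := fun x => by
    induction x using TensorProduct.induction_on with
    | zero => simp only [map_zero]
    | tmul a c => simp only [Algebra.TensorProduct.map_tmul, AlgHom.id_apply, hΔb, Bialgebra.comulAlgHom_apply]
    | add x y hx hy => simp only [map_add, hx, hy]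
  have key2 : ∀ x : B ⊗[R] B,
      Algebra.TensorProduct.map (AlgHom.id R C) ΔC (Algebra.TensorProduct.map π π x) =
        Algebra.TensorProduct.map π (Algebra.TensorProduct.map π π)
          (Algebra.TensorProduct.map (AlgHom.id R B) (Bialgebra.comulAlgHom R B) x) := fun x => by
    induction x using TensorProduct.induction_on with
    | zero => simp only [map_zero]
    | tmul a c => simp only [Algebra.TensorProduct.map_tmul, AlgHom.id_apply, hΔb, Bialgebra.comulAlgHom_apply]
    | add x y hx hy => simp only [map_add, hx, hy]
  have hassoc : ∀ x : (B ⊗[R] B) ⊗[R] B,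
      (Algebra.TensorProduct.assoc R R R C C C) (Algebra.TensorProduct.map (Algebra.TensorProduct.map π π) π x) =
        Algebra.TensorProduct.map π (Algebra.TensorProduct.map π π) (Algebra.TensorProduct.assoc R R R B B B x) :=
    fun x => by
    induction x using TensorProduct.induction_on with
    | zero => simp
    | tmul x y =>
        induction x using TensorProduct.induction_on with
        | zero => simp
        | tmul a c => rfl
        | add a c ha hc => simp only [TensorProduct.add_tmul, map_add, ha, hc]
    | add x y hx hy => rw [map_add, map_add, map_add, map_add, hx, hy]
  simp only [AlgHom.comp_apply]
  rw [hΔb, key1, key2]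
  change (Algebra.TensorProduct.assoc R R R C C C) _ = _
  rw [hassoc, assoc_map_comul_id_comul]

end DescentLaws

section LocalizedLaws

variable {R : Type u} [CommRing R] [IsLocalRing R] {B : Type v} [CommRing B] [Bialgebra R B]
  [h𝔫 : (RingHom.ker ((residue R).comp (Bialgebra.counitAlgHom R B : B →+* R))).IsMaximal]

/-! The instance argument `h𝔫` (`𝔫_ε` maximal — always true, ★ `Idempotents.isMaximal_ker_residue_comp`) only feeds
`Localization.AtPrime`; callers discharge it with `haveI := (Idempotents.isMaximal_ker_residue_comp (counitAlgHom R B)).1`. -/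

/-- Counit law `h_rTensor` for any pair `(ΔL, εL)` on the unit local factor `Localization.AtPrime 𝔫_ε` through which `Δ, ε` descend
(★ (B4) `existsUnique_comul_localization` ∕ `existsUnique_counit_localization`). [cite: Tate1997FiniteFlatGroupSchemes, (3.7) (I)] -/
theorem map_counit_id_comp_comul_localization
    (ΔL : Localization.AtPrime (RingHom.ker ((residue R).comp (Bialgebra.counitAlgHom R B : B →+* R))) →ₐ[R] Localization.AtPrime (RingHom.ker ((residue R).comp (Bialgebra.counitAlgHom R B : B →+* R))) ⊗[R] Localization.AtPrime (RingHom.ker ((residue R).comp (Bialgebra.counitAlgHom R B : B →+* R))))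
    (hΔL : ΔL.comp (IsScalarTower.toAlgHom R B _) =
        (Algebra.TensorProduct.map (IsScalarTower.toAlgHom R B _) (IsScalarTower.toAlgHom R B _)).comp
          (Bialgebra.comulAlgHom R B))
    (εL : Localization.AtPrime (RingHom.ker ((residue R).comp (Bialgebra.counitAlgHom R B : B →+* R))) →ₐ[R] R) (hεL : εL.comp (IsScalarTower.toAlgHom R B _) = Bialgebra.counitAlgHom R B) :
    (Algebra.TensorProduct.map εL (AlgHom.id R _)).comp ΔL = ((Algebra.TensorProduct.lid R (Localization.AtPrime (RingHom.ker ((residue R).comp (Bialgebra.counitAlgHom R B : B →+* R))))).symm : Localization.AtPrime (RingHom.ker ((residue R).comp (Bialgebra.counitAlgHom R B : B →+* R))) →ₐ[R] R ⊗[R] Localization.AtPrime (RingHom.ker ((residue R).comp (Bialgebra.counitAlgHom R B : B →+* R)))) :=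
  map_counit_id_comp_comul_of_comp_eq (IsScalarTower.toAlgHom R B _) (fun f g h => algHom_localization_ext _ f g h) ΔL hΔL εL hεL

/-- Counit law `h_lTensor` for the localised pair. [cite: Tate1997FiniteFlatGroupSchemes, (3.7) (I)] -/
theorem map_id_counit_comp_comul_localization
    (ΔL : Localization.AtPrime (RingHom.ker ((residue R).comp (Bialgebra.counitAlgHom R B : B →+* R))) →ₐ[R] Localization.AtPrime (RingHom.ker ((residue R).comp (Bialgebra.counitAlgHom R B : B →+* R))) ⊗[R] Localization.AtPrime (RingHom.ker ((residue R).comp (Bialgebra.counitAlgHom R B : B →+* R))))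
    (hΔL : ΔL.comp (IsScalarTower.toAlgHom R B _) =
        (Algebra.TensorProduct.map (IsScalarTower.toAlgHom R B _) (IsScalarTower.toAlgHom R B _)).comp
          (Bialgebra.comulAlgHom R B))
    (εL : Localization.AtPrime (RingHom.ker ((residue R).comp (Bialgebra.counitAlgHom R B : B →+* R))) →ₐ[R] R) (hεL : εL.comp (IsScalarTower.toAlgHom R B _) = Bialgebra.counitAlgHom R B) :
    (Algebra.TensorProduct.map (AlgHom.id R _) εL).comp ΔL = ((Algebra.TensorProduct.rid R R (Localization.AtPrime (RingHom.ker ((residue R).comp (Bialgebra.counitAlgHom R B : B →+* R))))).symm : Localization.AtPrime (RingHom.ker ((residue R).comp (Bialgebra.counitAlgHom R B : B →+* R))) →ₐ[R] Localization.AtPrime (RingHom.ker ((residue R).comp (Bialgebra.counitAlgHom R B : B →+* R))) ⊗[R] R) :=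
  map_id_counit_comp_comul_of_comp_eq (IsScalarTower.toAlgHom R B _) (fun f g h => algHom_localization_ext _ f g h) ΔL hΔL εL hεL

/-! Coassociativity of the localised comultiplication is `coassoc_comul_of_comp_eq (IsScalarTower.toAlgHom R B _)
(fun f g h => algHom_localization_ext _ f g h) ΔL hΔL` (not restated as a separate declaration: elaborating the
`Algebra.TensorProduct.assoc` statement over `Localization.AtPrime` triples trips the default heartbeat budget on instance
defeq, while the generic lemma instantiates instantly at any use site that already holds the associator term). -/

end LocalizedLaws

/-! ## §4 The special fibre of the unit factor -/

section SpecialFibre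

variable {R : Type u} [CommRing R] [IsLocalRing R] {B : Type v} [CommRing B] [Bialgebra R B]

/-- **The special fibre `k ⊗_R B₀` of the unit corner is LOCAL** — it is the factor of the special fibre `k ⊗_R B` through the unit
(Mathlib: the fibre of a local algebra over the closed point is local). [cite: Tate1997FiniteFlatGroupSchemes, (3.7) Lemma 3)] -/
theorem isLocalRing_residueField_tensor_unitCorner [Module.Finite R B] {e : B}
    (he1 : e - 1 ∈ RingHom.ker ((residue R).comp (Bialgebra.counitAlgHom R B : B →+* R)))
    (he0 : ∀ 𝔫 : Ideal B, 𝔫.IsMaximal → 𝔫 ≠ RingHom.ker ((residue R).comp (Bialgebra.counitAlgHom R B : B →+* R)) →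
      e ∈ 𝔫) :
    IsLocalRing (ResidueField R ⊗[R] (B ⧸ Ideal.span {1 - e})) := by
  haveI := (isLocalRing_unitCorner (R := R) he1 he0).1
  haveI : Module.Finite R (B ⧸ Ideal.span {1 - e}) :=
    Module.Finite.of_surjective (Ideal.Quotient.mkₐ R (Ideal.span {1 - e})).toLinearMap (Ideal.Quotient.mkₐ_surjective R _)
  haveI : IsLocalHom (algebraMap R (B ⧸ Ideal.span {1 - e})) :=
    Literature.RingTheory.Idempotents.isLocalHom_algebraMap_of_module_finite (R := R) (C := B ⧸ Ideal.span {1 - e})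
  infer_instance

/-- **`[G⁰ : S] = [Ḡ⁰ : Spec k]`**: for `B` finite free over the local `R` (henselian, so that the unit idempotent exists), the
`k`-rank of the special fibre of the unit factor equals its `R`-rank. [cite: Tate1997FiniteFlatGroupSchemes, (3.7) (I)] -/
theorem finrank_residueField_tensor_localization_eq {R : Type u} [CommRing R] [HenselianLocalRing R] {B : Type v} [CommRing B]
    [Bialgebra R B] [Module.Finite R B] [Module.Free R B] :
    haveI := (Literature.RingTheory.Idempotents.isMaximal_ker_residue_comp (Bialgebra.counitAlgHom R B)).1
    Module.finrank (ResidueField R)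
        (ResidueField R ⊗[R] Localization.AtPrime (RingHom.ker ((residue R).comp (Bialgebra.counitAlgHom R B : B →+* R)))) =
      Module.finrank R (Localization.AtPrime (RingHom.ker ((residue R).comp (Bialgebra.counitAlgHom R B : B →+* R)))) := by
  haveI := (Literature.RingTheory.Idempotents.isMaximal_ker_residue_comp (Bialgebra.counitAlgHom R B)).1
  obtain ⟨e, he, he1, he0⟩ := exists_unit_idempotent (R := R) (B := B)
  haveI := free_localization_atPrime (R := R) _ he he1 he0
  haveI := finite_localization_atPrime (R := R) _ he he1 he0
  exact Module.finrank_baseChange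

end SpecialFibre

/-! ## §5 Surjectivity of the reduction map on points -/

section Surjective

variable {Ω : Type} [Field Ω] [IsAlgClosed Ω] (V : ValuationSubring Ω) {B : Type} [CommRing B] [Algebra V B]
  [Module.Finite V B] [Module.Free V B]

/-- **Reduction is SURJECTIVE on points** over the valuation ring `V` of an algebraically closed field: for `B` finite free with
reduced generic fibre, every `κ(V)`-point `χ : B →ₐ[V] κ(V)` lifts to a `V`-point (`residue ∘ ψ = χ`), since the fibre over `χ`
has `rank_V B_{ker χ} ≥ 1` elements (★ `card_algHom_residue_comp_eq_finrank_localization`).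
[cite: Tate1997FiniteFlatGroupSchemes, (3.7)] [cite: StacksProject, Tag 04GG] -/
theorem exists_algHom_residue_comp_eq [IsReduced (Ω ⊗[↥V] B)] (χ : B →ₐ[↥V] ResidueField ↥V) :
    ∃ ψ : B →ₐ[↥V] ↥V, (residue ↥V).comp (ψ : B →+* ↥V) = (χ : B →+* ResidueField ↥V) := by
  classical
  haveI h𝔫 := isMaximal_ker_algHom_residueField V χ
  have hcard := card_algHom_residue_comp_eq_finrank_localization V χ
  -- the local factor at `ker χ` is finite free and non-zero, hence of positive rank
  haveI := Literature.RingTheory.Idempotents.isArtinianRing_quotient (R := ↥V) (A := B)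
  haveI : Fintype (MaximalSpectrum (B ⧸ (maximalIdeal ↥V).map (algebraMap (↥V) B))) := Fintype.ofFinite _
  obtain ⟨f, hf, hsep1, hsep0, -⟩ := V.exists_completeOrthogonalIdempotents_isLocalRing (A := B)
  set 𝔫 : Ideal B := RingHom.ker (χ : B →+* ResidueField ↥V) with h𝔫def
  let I : MaximalSpectrum (B ⧸ (maximalIdeal ↥V).map (algebraMap (↥V) B)) :=
    ⟨𝔫.map (Ideal.Quotient.mk _), Literature.RingTheory.Idempotents.isMaximal_map_mk (R := ↥V) 𝔫 h𝔫⟩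
  have hI : I.asIdeal.comap (Ideal.Quotient.mk ((maximalIdeal ↥V).map (algebraMap (↥V) B))) = 𝔫 :=
    Literature.RingTheory.Idempotents.comap_map_mk (R := ↥V) 𝔫 h𝔫
  have he1 : f I - 1 ∈ 𝔫 := by
    have h1 : 1 - f I ∈ 𝔫 := hI ▸ hsep1 I
    have := 𝔫.neg_mem h1
    rwa [neg_sub] at this
  have he0 : ∀ 𝔫' : Ideal B, 𝔫'.IsMaximal → 𝔫' ≠ 𝔫 → f I ∈ 𝔫' := fun 𝔫' h𝔫' hne => by
    let I' : MaximalSpectrum (B ⧸ (maximalIdeal ↥V).map (algebraMap (↥V) B)) :=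
      ⟨𝔫'.map (Ideal.Quotient.mk _), Literature.RingTheory.Idempotents.isMaximal_map_mk (R := ↥V) 𝔫' h𝔫'⟩
    have hI' : I'.asIdeal.comap (Ideal.Quotient.mk ((maximalIdeal ↥V).map (algebraMap (↥V) B))) = 𝔫' :=
      Literature.RingTheory.Idempotents.comap_map_mk (R := ↥V) 𝔫' h𝔫'
    have hne' : I ≠ I' := fun h => hne (by rw [← hI', ← h, hI])
    exact hI' ▸ hsep0 I I' hne'
  haveI := free_localization_atPrime (R := ↥V) 𝔫 (hf.idem I) he1 he0
  haveI := finite_localization_atPrime (R := ↥V) 𝔫 (hf.idem I) he1 he0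
  haveI : Nontrivial (Localization.AtPrime 𝔫) := inferInstance
  have hpos : 0 < Module.finrank (↥V) (Localization.AtPrime 𝔫) :=
    (Module.finrank_pos_iff_of_free (↥V) (Localization.AtPrime 𝔫)).2 inferInstance
  rw [← hcard] at hpos
  obtain ⟨⟨ψ, hψ⟩⟩ := Nat.card_pos_iff.1 hpos |>.1
  exact ⟨ψ, hψ⟩

end Surjective

end Literature.RingTheory.Henselian

end
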